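import Literature.Computability.AlgebraicComplexity.AsymptoticSumInequalityAsymptoticRank
import Literature.Computability.AlgebraicComplexity.MatMulMonomialSubrank
import Literature.Barriers.MatrixMultiplication.UniversalMethodBarrierAsymptoticRank
import Mathlib.Analysis.SpecialFunctions.Pow.Continuity
import HarnessLib

/-!
# `R̃(⟨q,q,q⟩) = q^ω`, i.e. `ω = log_q R̃(⟨q,q,q⟩)` (ADVXXZ 2025, §3.4) — proved

Topic `Literature/Computability/AlgebraicComplexity`.  Alman–Duan–Vassilevska Williams–Xu–Xu–Zhou
(SODA 2025 = arXiv:2404.16349, §3.4) define `ω := inf_{q ≥ 2} log_q R(⟨q,q,q⟩)` and note: "Since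
`⟨q,q,q⟩^{⊗n} ≡ ⟨qⁿ,qⁿ,qⁿ⟩`, equivalently `ω` can be written in terms of the asymptotic rank of
`⟨q,q,q⟩` as `ω = log_q (R̃(⟨q,q,q⟩))`."  In the tree's conventions (`omega K` = the infimum of the
admissible exponents, `MatrixMultiplicationExponent.lean`; `asymptoticRank` = `inf_N R(t^{⊗N})^{1/N}`,
`AsymptoticSpectrum.lean`) we prove, over any field `K`:

* `tensorRestrictsTo_matMulTensor_pow_kroneckerPow` — `⟨k^L, m^L, n^L⟩ ≥ ⟨k,m,n⟩^{⊗L}` (the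
  relabelling `⟨q,q,q⟩^{⊗n} ≡ ⟨qⁿ,qⁿ,qⁿ⟩`, converse direction of
  `tensorMonRestrictsTo_kroneckerPow_matMulTensor`);
* `asymptoticRank_matMulTensor_le_rpow_omega` — `R̃(⟨q,q,q⟩) ≤ q^ω` (`q ≥ 1`);
* `rpow_omega_le_asymptoticRank_matMulTensor` — `q^ω ≤ R̃(⟨q,q,q⟩)` (the asymptotic sum inequality
  with one summand, `sum_rpow_omega_le_asymptoticRank`);
* `asymptoticRank_matMulTensor : R̃(⟨q,q,q⟩) = q^ω` (`q ≥ 1`) and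
  `advxxz2025_omega_eq_logb_asymptoticRank : ω = log_q R̃(⟨q,q,q⟩)` (`q ≥ 2`).

No definitions, no named facts.

## References

* J. Alman, R. Duan, V. Vassilevska Williams, Y. Xu, Z. Xu, R. Zhou, *More asymmetry yields faster
  matrix multiplication*, SODA 2025 = arXiv:2404.16349, §3.4. [AlmanDuanVassilevskaWilliamsXuXuZhou2025]
* P. Bürgisser, M. Clausen, M. A. Shokrollahi, *Algebraic Complexity Theory* (1997), §15.5
  ((15.11) and Ex. 15.24(7)). [BurgisserClausenShokrollahi1997]
-/

noncomputable section

open scoped BigOperators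
open Filter Topology

namespace Literature.Computability.AlgebraicComplexity

open Literature.Barriers.MatrixMultiplication (asymptoticRank_le_of_polyDegeneratesTo)

/-! ## `⟨k^L, m^L, n^L⟩ ≥ ⟨k,m,n⟩^{⊗L}` -/

section Relabel

variable (K : Type) [Field K]

/-- **`⟨k,m,n⟩^{⊗L}` as a relabelling of `⟨k^L, m^L, n^L⟩`** (ADVXXZ §3.4:
"`⟨q,q,q⟩^{⊗n} ≡ ⟨qⁿ,qⁿ,qⁿ⟩`"). [cite: AlmanDuanVassilevskaWilliamsXuXuZhou2025, §3.4] -/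
theorem kroneckerPow_matMulTensor_eq_comp (k m n L : ℕ) :
    kroneckerPow (matMulTensor K k m n) L = fun a b c =>
      matMulTensor K (k ^ L) (m ^ L) (n ^ L)
        (finFunctionFinEquiv (fun i => (a i).1), finFunctionFinEquiv (fun i => (a i).2))
        (finFunctionFinEquiv (fun i => (b i).1), finFunctionFinEquiv (fun i => (b i).2))
        (finFunctionFinEquiv (fun i => (c i).1), finFunctionFinEquiv (fun i => (c i).2)) := by
  funext a b c
  rw [matMulTensor_pow_eq_kroneckerPow_comp K k m n L]
  simp only [Equiv.symm_apply_apply, Prod.mk.eta]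

/-- **`⟨k^L, m^L, n^L⟩ ≥ ⟨k,m,n⟩^{⊗L}`** (restriction along the relabelling).
[cite: AlmanDuanVassilevskaWilliamsXuXuZhou2025, §3.4] -/
theorem tensorRestrictsTo_matMulTensor_pow_kroneckerPow (k m n L : ℕ) :
    TensorRestrictsTo (matMulTensor K (k ^ L) (m ^ L) (n ^ L)) (kroneckerPow (matMulTensor K k m n) L) := by
  rw [kroneckerPow_matMulTensor_eq_comp K k m n L]
  exact tensorRestrictsTo_precomp _ _ _ _

/-- `R(⟨k,m,n⟩^{⊗L}) ≤ R(⟨k^L, m^L, n^L⟩)`. [cite: AlmanDuanVassilevskaWilliamsXuXuZhou2025, §3.4] -/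
theorem tensorRank_kroneckerPow_matMulTensor_le (k m n L : ℕ) :
    tensorRank (kroneckerPow (matMulTensor K k m n) L) ≤ tensorRank (matMulTensor K (k ^ L) (m ^ L) (n ^ L)) :=
  (tensorRestrictsTo_matMulTensor_pow_kroneckerPow K k m n L).tensorRank_le

/-- The one-summand direct sum `⊕_{i<1} ⟨q,q,q⟩` is a relabelling of `⟨q,q,q⟩`. [folklore] -/
theorem tensorRestrictsTo_matMulTensor_matMulDirectSum_one (q : ℕ) :
    TensorRestrictsTo (matMulTensor K q q q)
      (matMulDirectSum K (fun _ : Fin 1 => q) (fun _ => q) (fun _ => q)) := by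
  have key : matMulDirectSum K (fun _ : Fin 1 => q) (fun _ => q) (fun _ => q) =
      fun a b c => matMulTensor K q q q a.2 b.2 c.2 := by
    funext a b c
    simp only [matMulDirectSum, matMulTensor]
    refine ite_congr_prop ?_
    simp only [Subsingleton.elim a.1 b.1, Subsingleton.elim b.1 c.1, true_and, Fin.ext_iff]
  rw [key]
  exact tensorRestrictsTo_precomp _ _ _ _

end Relabel

/-! ## `R̃(⟨q,q,q⟩) = q^ω` -/

section Main

variable (K : Type) [Field K]

/-- **`q^ω ≤ R̃(⟨q,q,q⟩)`** (asymptotic sum inequality with a single summand; ADVXXZ §3.4–§3.5).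
[cite: AlmanDuanVassilevskaWilliamsXuXuZhou2025, §3.4] -/
theorem rpow_omega_le_asymptoticRank_matMulTensor (q : ℕ) :
    (q : ℝ) ^ omega K ≤ asymptoticRank (matMulTensor K q q q) := by
  classical
  have h := sum_rpow_omega_le_asymptoticRank K (fun _ : Fin 1 => q) (fun _ => q) (fun _ => q)
  simp only [Finset.univ_unique, Finset.sum_singleton] at h
  have hq : (((q * q * q : ℕ)) : ℝ) ^ (omega K / 3) = (q : ℝ) ^ omega K := by
    push_cast
    rw [show (q : ℝ) * q * q = (q : ℝ) ^ (3 : ℕ) by ring, ← Real.rpow_natCast,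
      ← Real.rpow_mul (Nat.cast_nonneg _)]
    congr 1; push_cast; ring
  rw [hq] at h
  exact h.trans (asymptoticRank_le_of_polyDegeneratesTo
    (tensorRestrictsTo_matMulTensor_matMulDirectSum_one K q).polyDegeneratesTo)

/-- **`R̃(⟨q,q,q⟩) ≤ q^ω`** for `q ≥ 1` (`R(⟨q,q,q⟩^{⊗M}) ≤ R(⟨q^M,q^M,q^M⟩) ≤ C_δ q^{M(ω+δ)}`,
`M`-th roots, `M → ∞`, `δ → 0`). [cite: AlmanDuanVassilevskaWilliamsXuXuZhou2025, §3.4] -/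
theorem asymptoticRank_matMulTensor_le_rpow_omega (q : ℕ) (hq : 1 ≤ q) :
    asymptoticRank (matMulTensor K q q q) ≤ (q : ℝ) ^ omega K := by
  have hq0 : (0 : ℝ) < q := by exact_mod_cast hq
  -- for every `δ > 0`: `R̃ ≤ q^{ω+δ}`
  have hδ : ∀ δ : ℝ, 0 < δ → asymptoticRank (matMulTensor K q q q) ≤ (q : ℝ) ^ (omega K + δ) := by
    intro δ hδ
    obtain ⟨C, hC, hCb⟩ := exists_tensorRank_matMulTensor_le_rpow K hδ
    -- `R̃ ≤ C^{1/M} q^{ω+δ}` for every `M = N + 1`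
    have hM : ∀ N : ℕ, asymptoticRank (matMulTensor K q q q) ≤
        C ^ (((N : ℝ) + 1)⁻¹) * (q : ℝ) ^ (omega K + δ) := by
      intro N
      have hN1 : (0 : ℝ) < (N : ℝ) + 1 := by positivity
      have hbdd : BddBelow (Set.range fun N : ℕ =>
          ((tensorRank (kroneckerPow (matMulTensor K q q q) (N + 1)) : ℝ) ^ ((N : ℝ) + 1)⁻¹)) :=
        ⟨0, by rintro _ ⟨N, rfl⟩; positivity⟩
      refine (ciInf_le hbdd N).trans ?_
      have h1 : (tensorRank (kroneckerPow (matMulTensor K q q q) (N + 1)) : ℝ) ≤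
          C * ((q : ℝ) ^ (omega K + δ)) ^ ((N : ℝ) + 1) := by
        have hle := tensorRank_kroneckerPow_matMulTensor_le K q q q (N + 1)
        have hqN : 1 ≤ q ^ (N + 1) := Nat.one_le_pow _ _ hq
        calc (tensorRank (kroneckerPow (matMulTensor K q q q) (N + 1)) : ℝ)
            ≤ tensorRank (matMulTensor K (q ^ (N + 1)) (q ^ (N + 1)) (q ^ (N + 1))) := by
              exact_mod_cast hle
          _ ≤ C * (((q ^ (N + 1) : ℕ)) : ℝ) ^ (omega K + δ) := hCb _ hqN
          _ = C * ((q : ℝ) ^ (omega K + δ)) ^ ((N : ℝ) + 1) := by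
              push_cast
              rw [← Real.rpow_natCast, ← Real.rpow_mul hq0.le, ← Real.rpow_mul hq0.le]
              congr 2; push_cast; ring
      calc ((tensorRank (kroneckerPow (matMulTensor K q q q) (N + 1)) : ℝ)) ^ ((N : ℝ) + 1)⁻¹
          ≤ (C * ((q : ℝ) ^ (omega K + δ)) ^ ((N : ℝ) + 1)) ^ ((N : ℝ) + 1)⁻¹ :=
            Real.rpow_le_rpow (Nat.cast_nonneg _) h1 (inv_nonneg.2 hN1.le)
        _ = C ^ (((N : ℝ) + 1)⁻¹) * (q : ℝ) ^ (omega K + δ) := by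
            rw [Real.mul_rpow hC.le (by positivity), Real.rpow_rpow_inv (by positivity) hN1.ne']
    -- `C^{1/M} → 1`
    have hlim : Tendsto (fun N : ℕ => C ^ (((N : ℝ) + 1)⁻¹) * (q : ℝ) ^ (omega K + δ)) atTop
        (𝓝 (1 * (q : ℝ) ^ (omega K + δ))) := by
      refine Tendsto.mul_const _ ?_
      have h0 : Tendsto (fun N : ℕ => ((N : ℝ) + 1)⁻¹) atTop (𝓝 0) := by
        simpa [one_div] using tendsto_one_div_add_atTop_nhds_zero_nat (𝕜 := ℝ)
      have h1 : Tendsto (fun N : ℕ => Real.log C * ((N : ℝ) + 1)⁻¹) atTop (𝓝 (Real.log C * 0)) :=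
        h0.const_mul (Real.log C)
      rw [mul_zero] at h1
      have h2 := Real.continuous_exp.tendsto 0 |>.comp h1
      rw [Real.exp_zero] at h2
      refine h2.congr fun N => ?_
      simp only [Function.comp]
      rw [Real.rpow_def_of_pos hC]
    rw [one_mul] at hlim
    exact ge_of_tendsto' hlim hM
  -- `δ → 0`
  have hlim : Tendsto (fun δ : ℝ => (q : ℝ) ^ (omega K + δ)) (𝓝[>] 0) (𝓝 ((q : ℝ) ^ (omega K + 0))) := by
    have hc : ContinuousAt (fun x : ℝ => (q : ℝ) ^ x) (omega K + 0) :=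
      Real.continuousAt_const_rpow hq0.ne'
    have ht : Tendsto (fun δ : ℝ => omega K + δ) (𝓝[>] 0) (𝓝 (omega K + 0)) :=
      (tendsto_const_nhds.add tendsto_id).mono_left nhdsWithin_le_nhds
    exact hc.tendsto.comp ht
  rw [add_zero] at hlim
  refine ge_of_tendsto hlim ?_
  filter_upwards [self_mem_nhdsWithin] with δ hδ' using hδ δ hδ'

/-- **`R̃(⟨q,q,q⟩) = q^ω`** for `q ≥ 1`. [cite: AlmanDuanVassilevskaWilliamsXuXuZhou2025, §3.4] -/
theorem asymptoticRank_matMulTensor (q : ℕ) (hq : 1 ≤ q) :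
    asymptoticRank (matMulTensor K q q q) = (q : ℝ) ^ omega K :=
  le_antisymm (asymptoticRank_matMulTensor_le_rpow_omega K q hq) (rpow_omega_le_asymptoticRank_matMulTensor K q)

/-- **ADVXXZ §3.4: `ω = log_q R̃(⟨q,q,q⟩)`** for every `q ≥ 2`. [cite: AlmanDuanVassilevskaWilliamsXuXuZhou2025, §3.4] -/
theorem advxxz2025_omega_eq_logb_asymptoticRank (q : ℕ) (hq : 2 ≤ q) :
    omega K = Real.logb q (asymptoticRank (matMulTensor K q q q)) := by
  have hq1 : (1 : ℝ) < q := by exact_mod_cast hq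
  rw [asymptoticRank_matMulTensor K q (by omega), Real.logb_rpow (by positivity) hq1.ne']

end Main

end Literature.Computability.AlgebraicComplexity

end
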